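import Literature.MathematicalPhysics.QuantumFieldTheory.Balaban1983to89.FieldMeasureAnalyticZeroSetNull
import Literature.MathematicalPhysics.QuantumFieldTheory.Balaban1983to89.HaarDist1LevelHypersurface
import Literature.MathematicalPhysics.QuantumFieldTheory.Balaban1983to89.Node00.AveragingSmooth
import Literature.MathematicalPhysics.QuantumFieldTheory.Balaban1983to89.Node00.SmallFieldChiFixedOfRecord
import HarnessLib

/-!
# `BalabanUVNodes.N09ContourThresholdNull` — THE THRESHOLD SETS OF THE RECORD'S (0.16) BLOCK-CONTOUR CUT-OFF ARE `dU`-NULL: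
# `dU{U : |U(γ) − 1| = r} = 0` for EVERY lattice walk `γ` and every `r ≠ 0`, hence `χ^{(0.16)}` of record is `dU`-a.e. CONTINUOUS

Cell `pub-ymgap`, YM-PLAN Track A, DAG node N09 [Balaban1987RG1]; seat `pub-ymgap-dag-n09-w3` g3 (the HAND of seat
`pub-ymgap-dag-n09-w1` g4, bus 2026-08-28T05:26:49Z: «the a.e.-continuity of `chiFix016OfRecord` ∕ `chiOfRecord` at the record once
w2 g3's engine lands»).  `--kind proof --supports stmt-QuantumFields-20542 --as helper` (K1⁷), COUNT-NEUTRAL.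

HONEST FRAMING.  Kernel measure bookkeeping on NODE 00's objects read BY NAME: the product-Haar zero-set engine of seat n09-w2 g3
(`FieldMeasureAnalyticZeroSetNull.fieldMeasure_zeroSet_eq_zero`: a real-analytic `F` on `(bonds → M_N(ℂ))`, not identically zero on
`SU(N)`-configurations, has a `dU`-null zero set — [Mityagin2015] Prop. 1 + [BrockerTomDieck1985] IV (2.11) behind it), the
one-hypersurface level equation of the `dist1`-sphere of this seat's `HaarDist1LevelHypersurface` (`‖W − 1‖ = r ⇒
det((r² − 2)·1 + W + Wᴴ) = 0`), and def-B∕def-χ's ambient walk products `Node00.AveragingSmooth.holM ∕ loopM` (`↑(holAt U γ) =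
holM ↑U γ`, `C^ω` in the field).  NOTHING of Bałaban's analysis is asserted; no carrier re-pointed; (F1) (the Jacobian face of (0.4)),
(F3) and the FIBRE reading of (F2) are untouched, so N09's `hreg`∕`contTOn` stay DISPLAYED; N09 NOT discharged; K0⁷∕K1⁷ NOT closed;
counts unmoved (typed 28∕28 · discharged 5∕27); R4 = the conditional finite-𝕋⁴ rung `BalabanLadder.UV` only; the Yang–Mills mass gap
(Clay) is NOT proved by any of this; nothing continuum ∕ ℝ⁴ ∕ OS.

WHY (the located debt).  `pub-ymgap-node00-def-K0e/P7-LOCATOR-AUDIT.md` §4 (F2) asks for the nullity of configurations with a variable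
EXACTLY at a sharp threshold, because the record integrates SHARP characteristic functions over fibres; the ONE-variable form is
`HaarEigenvalueSphereNull` (n09-w1 g4), the ONE-plaquette form its `PlaquetteVariableHaarLaw` ∕ `…N09DomAltThresholdNull` (the second printed
small-field domain `domAltOfRecord`, `chiFixAltOfRecord`).  The record's OTHER fixed-threshold cut-off, [I] (0.16) p. 255 in CONTOUR form
(`Node00.chiFix016OfRecord ε₀ K k U = 1 ⟺ ∀ c i, |U(Γ ∪ [x,x′] ∪ (−Γ′) ∪ (−c)) − 1| < ε₀`, the loop variables of the averaging (0.4)),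
thresholds WORDS of up to `O(dL)` bond variables with repeated bonds — out of reach of the head–tail law of one plaquette, in reach of the
product engine through the determinant level equation.  THIS FILE: for every walk `γ` (§1), every (0.4) loop `(c, i)` (§2), the
threshold sets are `dU`-null, and (§3) `χ^{(0.16)}` of record is continuous at `dU`-almost every configuration of every level — the
dominated-convergence input for the (0.16)-keyed densities, in full product-Haar currency.

WHAT IS PROVED (theorems only; 0 definitions; 0 sorry; axioms standard).  `SU N = Matrix.specialUnitaryGroup (Fin N) ℂ`, `N ≥ 1`,
`dU = fieldMeasure P j (Matrix.specialUnitaryGroup (Fin N) ℂ)` (product Haar), `dist1 W = ‖W − 1‖` (L²-operator norm, `UnitaryModel`).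
* §1 walks: `holM_one` (`holM 1 γ = 1`), `analyticOnNhd_holM` (`V ↦ holM V γ` real-analytic), `dist1_holAt_eq` (`dist1 U(γ) = ‖holM ↑U γ − 1‖`),
  `continuous_dist1_holAt`, ★★ **`fieldMeasure_setOf_dist1_holAt_eq_eq_zero`** (`dU{U : dist1 U(γ) = r} = 0`, every walk `γ`, `r ≠ 0`),
  `fieldMeasure_setOf_dist1_holAt_mem_eq_zero` (countable families of radii), `ae_dist1_holAt_ne`.
* §2 the (0.4) loops: ★★ `fieldMeasure_setOf_dist1_loopHol_eq_eq_zero`, `fieldMeasure_setOf_exists_dist1_loopHol_eq_eq_zero`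
  (`dU{U : ∃ c i, dist1 (loopHol U c i) = r} = 0`), `ae_forall_dist1_loopHol_ne`, `isOpen_setOf_forall_dist1_loopHol_lt`,
  `frontier_setOf_forall_dist1_loopHol_lt_subset`, ★ `fieldMeasure_frontier_setOf_forall_dist1_loopHol_lt_eq_zero` (the (0.16)-small set
  `{∀ c i, dist1 < ε₀}` is a `dU`-CONTINUITY SET: its frontier is `dU`-null).
* §3 at the record (`F : T4Family`, torus `K`, level `k`): ★★ `fieldMeasure_thresholdSet_chiFix016OfRecord_eq_zero`,
  `continuousAt_chiFix016OfRecord_of_forall_ne` (off the threshold set `χ^{(0.16)}` is locally constant),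
  ★★★ **`ae_continuousAt_chiFix016OfRecord`** (`ε₀ ≠ 0` ⇒ `χ^{(0.16)}_k` is continuous at `dU`-a.e. `U`, every `K`, `k`).

LOCATED, NOT PROVED HERE.  The (2.17) cube functions `Node00.chiOfRecord` threshold `sup_{p ⊂ □̃} |U_{k,□}(V_k, ∂p) − 1|` on the LOCAL
MINIMISER background `ukBox` ((2.16)), which is NOT an entire function of the field (it is analytic only on the small-field domain, an N07∕[B11]
Thm 1 statement); the entire-`F` engine does not reach it — a located line for the (F1)∕N07 owners, not a w-item.

References: T. Bałaban, Commun. Math. Phys. **109** (1987) 249–301 [Balaban1987RG1] (0.4) p. 253, (0.16) p. 255; **98** (1985) 17–51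
[Balaban1985Averaging] (10) p. 19 (product Haar `dU`), (19) p. 21 (`|U − 1|`); B. S. Mityagin, Math. Notes **107** (2020) [Mityagin2015] Prop. 1;
Th. Bröcker, T. tom Dieck, GTM 98 (1985) [BrockerTomDieck1985] IV (2.11).
-/

noncomputable section

open Set Function Filter Topology MeasureTheory
open scoped ENNReal NNReal Matrix.Norms.L2Operator

namespace Summit.QuantumFields.YangMills.BalabanUVNodes.N09ContourThresholdNull

open Literature.MathematicalPhysics.QuantumFieldTheory
open Literature.MathematicalPhysics.QuantumFieldTheory.Balaban1983to89
open T4Continuum BlockAveraging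
open Node00 (coeField coeField_apply stepM holM holM_nil holM_cons contDiff_holM loopM coe_holAt coe_loopHol
  chiFix016OfRecord chiFix016OfRecord_eq_one_iff)
open FieldMeasureAnalyticZeroSetNull (fieldMeasure_zeroSet_eq_zero)
open HaarDist1LevelHypersurface (det_level_eq_zero_of_norm_sub_one_eq analyticOnNhd_det_level_comp det_level_one_ne_zero
  level_const_add_two_ne_zero)

/-! ## §1 Operator-norm thresholds of the holonomy along ANY walk are `dU`-null -/

section Walks

variable {P : Params} {j : ℕ} {N : ℕ}

/-- The walk product of the unit field is the unit: `holM 1 γ = 1`. [cite: Balaban1985Averaging, (9) p.19 (bookkeeping)] -/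
theorem holM_one (γ : List (LStep P j)) :
    holM (fun _ : PBond P j => (1 : Matrix (Fin N) (Fin N) ℂ)) γ = 1 := by
  induction γ with
  | nil => exact holM_nil _
  | cons s γ ih =>
    rw [holM_cons, ih, mul_one]
    unfold stepM
    split_ifs
    · rfl
    · exact star_one _

/-- **Walk products are REAL-ANALYTIC in the field** (they are `C^ω`, `Node00.AveragingSmooth.contDiff_holM`).
[cite: Balaban1987RG1, p.253 («analytic function»; bookkeeping)] -/
theorem analyticOnNhd_holM (γ : List (LStep P j)) :
    AnalyticOnNhd ℝ (fun V : PBond P j → Matrix (Fin N) (Fin N) ℂ => holM V γ) Set.univ :=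
  (contDiff_holM γ).analyticOnNhd

variable [NeZero N]

/-- `dist1` of a holonomy, read in `M_N(ℂ)`: `dist1 U(γ) = ‖holM ↑U γ − 1‖` (L²-operator norm). [cite: Balaban1985Averaging, (19) p.21] -/
theorem dist1_holAt_eq (U : GaugeField P j (Matrix.specialUnitaryGroup (Fin N) ℂ)) (γ : List (LStep P j)) :
    dist1 (holAt U γ) = ‖holM (coeField U) γ - 1‖ := by
  rw [← coe_holAt U γ]
  rfl

/-- `U ↦ dist1 U(γ)` is continuous (a continuous function of the continuous walk product of the bond matrices).
[cite: Balaban1985Averaging, (19) p.21 (bookkeeping)] -/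
theorem continuous_dist1_holAt (γ : List (LStep P j)) :
    Continuous fun U : GaugeField P j (Matrix.specialUnitaryGroup (Fin N) ℂ) => dist1 (holAt U γ) := by
  have hcoe : Continuous (coeField : GaugeField P j (Matrix.specialUnitaryGroup (Fin N) ℂ) → PBond P j → Matrix (Fin N) (Fin N) ℂ) :=
    continuous_pi fun b => continuous_subtype_val.comp (continuous_apply b)
  have h : Continuous fun U : GaugeField P j (Matrix.specialUnitaryGroup (Fin N) ℂ) => ‖holM (coeField U) γ - 1‖ :=
    (((contDiff_holM γ).continuous.comp hcoe).sub continuous_const).norm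
  refine h.congr fun U => ?_
  exact (dist1_holAt_eq U γ).symm

/-- ★★ **`dU{U : dist1 U(γ) = r} = 0` FOR EVERY WALK `γ` AND EVERY `r ≠ 0`** (product Haar on `SU(N)`-configurations, every torus and
level): the threshold set lies in the zero set of the real-analytic `V ↦ det((r² − 2)·1 + holM V γ + (holM V γ)ᴴ)`
(`HaarDist1LevelHypersurface`), which equals `(r²)^N ≠ 0` at `V ≡ 1`, hence is `dU`-null by the product-Haar zero-set engine
(`FieldMeasureAnalyticZeroSetNull.fieldMeasure_zeroSet_eq_zero`). [cite: Balaban1985Averaging, (10) p.19 and (19) p.21]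
[cite: BrockerTomDieck1985, IV (2.11) (proof)] [cite: Mityagin2015, Proposition 1] -/
theorem fieldMeasure_setOf_dist1_holAt_eq_eq_zero (γ : List (LStep P j)) {r : ℝ} (hr : r ≠ 0) :
    fieldMeasure P j (Matrix.specialUnitaryGroup (Fin N) ℂ) {U : GaugeField P j (Matrix.specialUnitaryGroup (Fin N) ℂ) | dist1 (holAt U γ) = r} = 0 := by
  set F : (PBond P j → Matrix (Fin N) (Fin N) ℂ) → ℂ :=
    fun V => (((r ^ 2 - 2 : ℝ) : ℂ) • (1 : Matrix (Fin N) (Fin N) ℂ) + holM V γ + (holM V γ).conjTranspose).det with hFdef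
  have hF : AnalyticOnNhd ℝ F Set.univ := analyticOnNhd_det_level_comp (analyticOnNhd_holM γ) _
  have hsub : {U : GaugeField P j (Matrix.specialUnitaryGroup (Fin N) ℂ) | dist1 (holAt U γ) = r} ⊆
      {U | F (fun b => ((U b : Matrix.specialUnitaryGroup (Fin N) ℂ) : Matrix (Fin N) (Fin N) ℂ)) = 0} := by
    intro U hU
    have hU' : ‖holM (coeField U) γ - 1‖ = r := by rw [← dist1_holAt_eq]; exact hU
    have hunit : holM (coeField U) γ ∈ Matrix.unitaryGroup (Fin N) ℂ := by
      rw [← coe_holAt U γ]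
      exact (Matrix.mem_specialUnitaryGroup_iff.mp (holAt U γ).2).1
    exact det_level_eq_zero_of_norm_sub_one_eq hunit hU'
  refine measure_mono_null hsub (fieldMeasure_zeroSet_eq_zero P j hF ⟨fun _ => 1, ?_⟩)
  have h1 : (fun b : PBond P j => (((fun _ : PBond P j => (1 : Matrix.specialUnitaryGroup (Fin N) ℂ)) b : Matrix.specialUnitaryGroup (Fin N) ℂ) : Matrix (Fin N) (Fin N) ℂ)) =
      fun _ => (1 : Matrix (Fin N) (Fin N) ℂ) := rfl
  rw [h1]
  show (((r ^ 2 - 2 : ℝ) : ℂ) • (1 : Matrix (Fin N) (Fin N) ℂ) + holM (fun _ => 1) γ + (holM (fun _ => 1) γ).conjTranspose).det ≠ 0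
  rw [holM_one]
  exact det_level_one_ne_zero (level_const_add_two_ne_zero hr)

/-- **COUNTABLE FAMILIES OF THRESHOLDS AT ONCE**: `dU{U : dist1 U(γ) ∈ R} = 0` for every countable `R ∌ 0` (all `ε₀L^{−2k}`, `ε_k`, `δ_k`).
[cite: Balaban1985Averaging, (10) p.19 and (19) p.21] [cite: BrockerTomDieck1985, IV (2.11) (proof)] -/
theorem fieldMeasure_setOf_dist1_holAt_mem_eq_zero (γ : List (LStep P j)) {R : Set ℝ} (hR : R.Countable) (hR0 : (0 : ℝ) ∉ R) :
    fieldMeasure P j (Matrix.specialUnitaryGroup (Fin N) ℂ) {U : GaugeField P j (Matrix.specialUnitaryGroup (Fin N) ℂ) | dist1 (holAt U γ) ∈ R} = 0 := by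
  have hset : {U : GaugeField P j (Matrix.specialUnitaryGroup (Fin N) ℂ) | dist1 (holAt U γ) ∈ R} =
      ⋃ r ∈ R, {U : GaugeField P j (Matrix.specialUnitaryGroup (Fin N) ℂ) | dist1 (holAt U γ) = r} := by
    ext U
    simp only [Set.mem_setOf_eq, Set.mem_iUnion, exists_prop, exists_eq_right']
  rw [hset, measure_biUnion_null_iff hR]
  intro r hrR
  exact fieldMeasure_setOf_dist1_holAt_eq_eq_zero γ (by rintro rfl; exact hR0 hrR)

/-- Almost-everywhere form: `dU`-a.e. `dist1 U(γ) ≠ r` (`r ≠ 0`). [cite: Balaban1985Averaging, (10) p.19 and (19) p.21] -/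
theorem ae_dist1_holAt_ne (γ : List (LStep P j)) {r : ℝ} (hr : r ≠ 0) :
    ∀ᵐ U ∂(fieldMeasure P j (Matrix.specialUnitaryGroup (Fin N) ℂ)), dist1 (holAt U γ) ≠ r := by
  rw [ae_iff]
  simpa only [not_not] using fieldMeasure_setOf_dist1_holAt_eq_eq_zero (N := N) γ hr

end Walks

/-! ## §2 The loop variables of the averaging (0.4): `dU{U : |U(Γ ∪ [x,x′] ∪ (−Γ′) ∪ (−c)) − 1| = r} = 0` -/

section Loops

variable {P : Params} {j : ℕ} {N : ℕ} [NeZero N]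

/-- ★★ **THE (0.4) LOOP VARIABLES ARE `dU`-a.s. OFF EVERY SPHERE**: `dU{U : dist1 (loopHol U c i) = r} = 0` for every coarse bond `c`,
every loop index `i` and every `r ≠ 0` (the loop variable is the holonomy along the closed walk word from the block centre).
[cite: Balaban1987RG1, (0.4) p.253] [cite: Balaban1985Averaging, (10) p.19] [cite: BrockerTomDieck1985, IV (2.11) (proof)] -/
theorem fieldMeasure_setOf_dist1_loopHol_eq_eq_zero (c : PBond P (j + 1)) (i : Idx P) {r : ℝ} (hr : r ≠ 0) :
    fieldMeasure P j (Matrix.specialUnitaryGroup (Fin N) ℂ) {U : GaugeField P j (Matrix.specialUnitaryGroup (Fin N) ℂ) | dist1 (loopHol U c i) = r} = 0 :=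
  fieldMeasure_setOf_dist1_holAt_eq_eq_zero _ hr

/-- **ALL LOOPS AT ONCE**: `dU{U : ∃ c i, dist1 (loopHol U c i) = r} = 0` (`r ≠ 0`; finitely many coarse bonds and loop indices).
[cite: Balaban1987RG1, (0.4) p.253] [cite: Balaban1985Averaging, (10) p.19] [cite: BrockerTomDieck1985, IV (2.11) (proof)] -/
theorem fieldMeasure_setOf_exists_dist1_loopHol_eq_eq_zero {r : ℝ} (hr : r ≠ 0) :
    fieldMeasure P j (Matrix.specialUnitaryGroup (Fin N) ℂ)
      {U : GaugeField P j (Matrix.specialUnitaryGroup (Fin N) ℂ) | ∃ (c : PBond P (j + 1)) (i : Idx P), dist1 (loopHol U c i) = r} = 0 := by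
  have hset : {U : GaugeField P j (Matrix.specialUnitaryGroup (Fin N) ℂ) | ∃ (c : PBond P (j + 1)) (i : Idx P), dist1 (loopHol U c i) = r} =
      ⋃ c : PBond P (j + 1), ⋃ i : Idx P, {U : GaugeField P j (Matrix.specialUnitaryGroup (Fin N) ℂ) | dist1 (loopHol U c i) = r} := by
    ext U
    simp only [Set.mem_setOf_eq, Set.mem_iUnion]
  rw [hset, measure_iUnion_null_iff]
  intro c
  rw [measure_iUnion_null_iff]
  intro i
  exact fieldMeasure_setOf_dist1_loopHol_eq_eq_zero c i hr

/-- Almost-everywhere form: `dU`-a.e. no (0.4) loop variable sits exactly on the sphere of radius `r ≠ 0`.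
[cite: Balaban1987RG1, (0.4) p.253] [cite: Balaban1985Averaging, (10) p.19] -/
theorem ae_forall_dist1_loopHol_ne {r : ℝ} (hr : r ≠ 0) :
    ∀ᵐ U ∂(fieldMeasure P j (Matrix.specialUnitaryGroup (Fin N) ℂ)), ∀ (c : PBond P (j + 1)) (i : Idx P), dist1 (loopHol U c i) ≠ r := by
  have h := fieldMeasure_setOf_exists_dist1_loopHol_eq_eq_zero (P := P) (j := j) (N := N) hr
  rw [← compl_mem_ae_iff] at h
  filter_upwards [h] with U hU c i hci
  exact hU ⟨c, i, hci⟩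

/-- **THE (0.16)-SMALL SET IS OPEN**: `{U : ∀ c i, dist1 (loopHol U c i) < ε₀}` is open (finitely many continuous loop functionals).
[cite: Balaban1987RG1, (0.16) p.255 and (0.4) p.253 (bookkeeping)] -/
theorem isOpen_setOf_forall_dist1_loopHol_lt (ε₀ : ℝ) :
    IsOpen {U : GaugeField P j (Matrix.specialUnitaryGroup (Fin N) ℂ) |
      ∀ (c : PBond P (j + 1)) (i : Idx P), dist1 (loopHol U c i) < ε₀} := by
  have hrepr : {U : GaugeField P j (Matrix.specialUnitaryGroup (Fin N) ℂ) |
      ∀ (c : PBond P (j + 1)) (i : Idx P), dist1 (loopHol U c i) < ε₀} =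
        ⋂ c : PBond P (j + 1), ⋂ i : Idx P, {U | dist1 (loopHol U c i) < ε₀} := by
    ext U; simp only [Set.mem_setOf_eq, Set.mem_iInter]
  rw [hrepr]
  exact isOpen_iInter_of_finite fun c => isOpen_iInter_of_finite fun i =>
    isOpen_lt (continuous_dist1_holAt _) continuous_const

/-- **THE FRONTIER OF THE (0.16)-SMALL SET LIES IN THE THRESHOLD SET**: `∂{∀ c i, dist1 < ε₀} ⊆ {∃ c i, dist1 = ε₀}` (the closure lies in
`{∀ c i, dist1 ≤ ε₀}`, the set itself is open). [cite: Balaban1987RG1, (0.16) p.255 (bookkeeping)] -/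
theorem frontier_setOf_forall_dist1_loopHol_lt_subset (ε₀ : ℝ) :
    frontier {U : GaugeField P j (Matrix.specialUnitaryGroup (Fin N) ℂ) |
        ∀ (c : PBond P (j + 1)) (i : Idx P), dist1 (loopHol U c i) < ε₀} ⊆
      {U | ∃ (c : PBond P (j + 1)) (i : Idx P), dist1 (loopHol U c i) = ε₀} := by
  intro U hU
  rw [(isOpen_setOf_forall_dist1_loopHol_lt ε₀).frontier_eq] at hU
  obtain ⟨hcl, hnot⟩ := hU
  have hle : ∀ (c : PBond P (j + 1)) (i : Idx P), dist1 (loopHol U c i) ≤ ε₀ := by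
    have hclosed : IsClosed {V : GaugeField P j (Matrix.specialUnitaryGroup (Fin N) ℂ) |
        ∀ (c : PBond P (j + 1)) (i : Idx P), dist1 (loopHol V c i) ≤ ε₀} := by
      have hrepr : {V : GaugeField P j (Matrix.specialUnitaryGroup (Fin N) ℂ) |
          ∀ (c : PBond P (j + 1)) (i : Idx P), dist1 (loopHol V c i) ≤ ε₀} =
            ⋂ c : PBond P (j + 1), ⋂ i : Idx P, {V | dist1 (loopHol V c i) ≤ ε₀} := by
        ext V; simp only [Set.mem_setOf_eq, Set.mem_iInter]
      rw [hrepr]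
      exact isClosed_iInter fun c => isClosed_iInter fun i => isClosed_le (continuous_dist1_holAt _) continuous_const
    have hsub : {V : GaugeField P j (Matrix.specialUnitaryGroup (Fin N) ℂ) |
        ∀ (c : PBond P (j + 1)) (i : Idx P), dist1 (loopHol V c i) < ε₀} ⊆
          {V | ∀ (c : PBond P (j + 1)) (i : Idx P), dist1 (loopHol V c i) ≤ ε₀} :=
      fun V hV c i => (hV c i).le
    exact closure_minimal hsub hclosed hcl
  simp only [Set.mem_setOf_eq, not_forall, not_lt] at hnot
  obtain ⟨c, i, hci⟩ := hnot
  exact ⟨c, i, le_antisymm (hle c i) hci⟩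

/-- ★ **THE (0.16)-SMALL SET IS A `dU`-CONTINUITY SET**: its frontier is `dU`-null (`ε₀ ≠ 0`) — the Portmanteau-ready form.
[cite: Balaban1987RG1, (0.16) p.255] [cite: Balaban1985Averaging, (10) p.19] [cite: BrockerTomDieck1985, IV (2.11) (proof)] -/
theorem fieldMeasure_frontier_setOf_forall_dist1_loopHol_lt_eq_zero {ε₀ : ℝ} (hε : ε₀ ≠ 0) :
    fieldMeasure P j (Matrix.specialUnitaryGroup (Fin N) ℂ)
      (frontier {U : GaugeField P j (Matrix.specialUnitaryGroup (Fin N) ℂ) |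
        ∀ (c : PBond P (j + 1)) (i : Idx P), dist1 (loopHol U c i) < ε₀}) = 0 :=
  measure_mono_null (frontier_setOf_forall_dist1_loopHol_lt_subset ε₀) (fieldMeasure_setOf_exists_dist1_loopHol_eq_eq_zero hε)

end Loops

/-! ## §3 At the record: the threshold set of `χ^{(0.16)}` is `dU`-null and `χ^{(0.16)}` is `dU`-a.e. continuous -/

section Record

variable {F : T4Family} {N : ℕ} [NeZero N]

/-- ★★ **THE THRESHOLD SET OF THE RECORD'S (0.16) CUT-OFF IS `dU`-NULL**: `dU{U : ∃ c i, dist1 (loopHol U c i) = ε₀} = 0` on the level-`k`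
configurations of the torus `K` of the family `F`, for every `ε₀ ≠ 0`. [cite: Balaban1987RG1, (0.16) p.255 and (0.4) p.253]
[cite: Balaban1985Averaging, (10) p.19] [cite: BrockerTomDieck1985, IV (2.11) (proof)] -/
theorem fieldMeasure_thresholdSet_chiFix016OfRecord_eq_zero (K k : ℕ) {ε₀ : ℝ} (hε : ε₀ ≠ 0) :
    fieldMeasure (F.P K) k (Matrix.specialUnitaryGroup (Fin N) ℂ)
      {U : GaugeField (F.P K) k (Matrix.specialUnitaryGroup (Fin N) ℂ) | ∃ (c : PBond (F.P K) (k + 1)) (i : Idx (F.P K)), dist1 (loopHol U c i) = ε₀} = 0 :=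
  fieldMeasure_setOf_exists_dist1_loopHol_eq_eq_zero hε

/-- `χ^{(0.16)} = 0` off its small-field set. [cite: Balaban1987RG1, (0.16) p.255 (bookkeeping)] -/
theorem chiFix016OfRecord_eq_zero_of_not (ε₀ : ℝ) (K k : ℕ) (U : GaugeField (F.P K) k (Matrix.specialUnitaryGroup (Fin N) ℂ))
    (h : ¬ ∀ (c : PBond (F.P K) (k + 1)) (i : Idx (F.P K)), dist1 (loopHol U c i) < ε₀) :
    chiFix016OfRecord F N ε₀ K k U = 0 := by
  unfold chiFix016OfRecord
  rw [if_neg h]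

/-- **OFF THE THRESHOLD SET, `χ^{(0.16)}` IS LOCALLY CONSTANT, HENCE CONTINUOUS**: if no loop variable of `U` sits exactly at `ε₀` then
`χ^{(0.16)}_k` is continuous at `U` (either all loop variables are `< ε₀` on a neighbourhood — value `1` — or one is `> ε₀` on a
neighbourhood — value `0`). [cite: Balaban1987RG1, (0.16) p.255] -/
theorem continuousAt_chiFix016OfRecord_of_forall_ne {ε₀ : ℝ} {K k : ℕ} {U : GaugeField (F.P K) k (Matrix.specialUnitaryGroup (Fin N) ℂ)}
    (h : ∀ (c : PBond (F.P K) (k + 1)) (i : Idx (F.P K)), dist1 (loopHol U c i) ≠ ε₀) :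
    ContinuousAt (chiFix016OfRecord F N ε₀ K k) U := by
  by_cases hall : ∀ (c : PBond (F.P K) (k + 1)) (i : Idx (F.P K)), dist1 (loopHol U c i) < ε₀
  · -- the open small-field set, value `1`
    have hopen : IsOpen {V : GaugeField (F.P K) k (Matrix.specialUnitaryGroup (Fin N) ℂ) | ∀ (c : PBond (F.P K) (k + 1)) (i : Idx (F.P K)),
        dist1 (loopHol V c i) < ε₀} := isOpen_setOf_forall_dist1_loopHol_lt ε₀
    refine (continuousAt_const : ContinuousAt (fun _ : GaugeField (F.P K) k (Matrix.specialUnitaryGroup (Fin N) ℂ) => (1 : ℝ)) U).congr ?_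
    filter_upwards [hopen.mem_nhds hall] with V hV
    exact ((chiFix016OfRecord_eq_one_iff ε₀ K k V).2 hV).symm
  · -- one loop variable strictly above threshold on a neighbourhood, value `0`
    simp only [not_forall, not_lt] at hall
    obtain ⟨c, i, hci⟩ := hall
    have hgt : ε₀ < dist1 (loopHol U c i) := lt_of_le_of_ne hci (h c i).symm
    have hopen : IsOpen {V : GaugeField (F.P K) k (Matrix.specialUnitaryGroup (Fin N) ℂ) | ε₀ < dist1 (loopHol V c i)} :=
      isOpen_lt continuous_const (continuous_dist1_holAt _)
    refine (continuousAt_const : ContinuousAt (fun _ : GaugeField (F.P K) k (Matrix.specialUnitaryGroup (Fin N) ℂ) => (0 : ℝ)) U).congr ?_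
    filter_upwards [hopen.mem_nhds hgt] with V hV
    refine (chiFix016OfRecord_eq_zero_of_not ε₀ K k V fun hV' => ?_).symm
    exact lt_irrefl _ ((hV' c i).trans hV)

/-- ★★★ **`χ^{(0.16)}` OF RECORD IS `dU`-ALMOST-EVERYWHERE CONTINUOUS** at every level `k` of every torus `K`, for every threshold `ε₀ ≠ 0` —
the dominated-convergence input for the (0.16)-keyed sharp cut-off, in full product-Haar currency (the FIBRE∕conditional-law reading needs
(F1), the Jacobian face of (0.4), and is NOT proved here). [cite: Balaban1987RG1, (0.16) p.255 and (0.4) p.253]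
[cite: Balaban1985Averaging, (10) p.19] [cite: BrockerTomDieck1985, IV (2.11) (proof)] [cite: Mityagin2015, Proposition 1] -/
theorem ae_continuousAt_chiFix016OfRecord (K k : ℕ) {ε₀ : ℝ} (hε : ε₀ ≠ 0) :
    ∀ᵐ U ∂(fieldMeasure (F.P K) k (Matrix.specialUnitaryGroup (Fin N) ℂ)), ContinuousAt (chiFix016OfRecord F N ε₀ K k) U := by
  filter_upwards [ae_forall_dist1_loopHol_ne (P := F.P K) (j := k) (N := N) hε] with U hU
  exact continuousAt_chiFix016OfRecord_of_forall_ne hU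

end Record

end Summit.QuantumFields.YangMills.BalabanUVNodes.N09ContourThresholdNull

end
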